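import Summits.QuantumFields.YangMills.Theorems.PencilRigidityNPointIsotropyOffDiagCutoff
import Summits.QuantumFields.YangMills.Theorems.PencilRigidityNPointIsotropyOffDiagCutoffTendsto
import Literature.MathematicalPhysics.QuantumLattice.SchwartzTensorDensityProofs
import Literature.MathematicalPhysics.QuantumLattice.SchwartzLocalDensity
import Literature.MathematicalPhysics.QuantumLattice.SchwartzOrderedWedgeDensity
import Literature.MathematicalPhysics.QuantumLattice.SchwartzTranslationCutoff
import Literature.MathematicalPhysics.AQFT.OffDiagonalFlatDecay
import HarnessLib

/-!
# Route `BoundedSkewnessRunning`, support item `OffDiagonalReduction` (stmt-QuantumFields-19900) — helper: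
# `⁰𝒮` is the closed span of the real product tensors with COMPACTLY SUPPORTED, PAIRWISE DISJOINT factors

The item reduces non-Gaussianity (`OSData.IsNonGaussian`, a connected three-point function on SOME off-diagonal
tensor `f ⊗ g ⊗ h ∈ ⁰𝒮`) to the connected three-point function on tensors of compactly supported real triples with
pairwise disjoint supports.  The density behind it, proved here for every arity `n`: every `F ∈ ⁰𝒮((ℝ⁴)ⁿ)`
(Schwartz, flat on the coincidence locus) lies in the closure of the `ℂ`-span of the real product tensors
`f₁ ⊗ ⋯ ⊗ fₙ` whose factors `fᵢ` are COMPACTLY SUPPORTED with PAIRWISE DISJOINT topological supports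
(`isOffDiagonal_mem_closure_span_disjointTensors`); functional form: a continuous linear functional on
`𝓢((ℝ⁴)ⁿ, ℂ)` vanishing on those tensors vanishes on `⁰𝒮` (`eq_zero_offDiagonal_of_forall_disjointTensor`).

This is the tree's wave-2 density of line `complex-rotation-bandlimit` (crux `PencilRigidity.NPointIsotropy`;
files `PencilRigidityNPointIsotropy{OffDiagCutoff,OffDiagCutoffTendsto,LocalOffDiagDensity,OffDiagDensity}`) with a
SMALLER generating set: the box tensors produced by the engine `SchwartzTensorDensityProofs.mem_closure_span_boxTensors`
already have factors supported in pairwise disjoint bounded boxes, so the same proof records compact, pairwise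
disjoint supports instead of mere off-diagonality.  The cut-off family and its Schwartz convergence are imported
(`offDiagCutoffFamily`, `offDiagCutoffTendsto`); the local step and the assembly are re-run here (the tree's
`LocalOffDiagDensity` / `OffDiagDensity` modules are adapted, not imported).  No summit, leg or crux is proved.

References: Hörmander I, Lemma 7.1.8 (compact cut-offs in `𝒮`); folklore (closed spans and kernels).
-/

noncomputable section

open scoped SchwartzMap Topology
open Filter Set Metric
open Literature.MathematicalPhysics.QuantumLattice Literature.MathematicalPhysics.AQFT
open Summit.QuantumFields.YangMills.Theorems.NPointIsotropy.ComplexRotationBandlimit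
  (offDiagCutoffFamily offDiagCutoffTendsto)

namespace Summit.QuantumFields.YangMills.Theorems.OffDiagonalReduction

/-! ## The local step: one piece of the lattice partition -/

/-- A closed coordinate box `{x : ℝ⁴ | ∀ c, l c ≤ x c ≤ u c}` is compact (closed and bounded). [folklore] -/
theorem isCompact_coordBox (l u : Fin 4 → ℝ) :
    IsCompact {x : EuclideanSpace ℝ (Fin 4) | ∀ c, l c ≤ x c ∧ x c ≤ u c} := by
  have hproj : ∀ c : Fin 4, Continuous fun x : EuclideanSpace ℝ (Fin 4) => x c := fun c =>
    (EuclideanSpace.proj c).continuous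
  refine Metric.isCompact_of_isClosed_isBounded ?_ ?_
  · simp only [Set.setOf_forall, Set.setOf_and]
    exact isClosed_iInter fun c =>
      (isClosed_le continuous_const (hproj c)).inter (isClosed_le (hproj c) continuous_const)
  · set M : ℝ := ∑ c, (|l c| + |u c|) with hM
    have hM0 : 0 ≤ M := Finset.sum_nonneg fun c _ => by positivity
    have hMc : ∀ c, |l c| + |u c| ≤ M := fun c =>
      Finset.single_le_sum (f := fun c => |l c| + |u c|) (fun c _ => by positivity) (Finset.mem_univ c)
    refine (Metric.isBounded_iff_subset_closedBall 0).mpr ⟨Real.sqrt (Fintype.card (Fin 4) : ℕ) * M, ?_⟩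
    intro x hx
    rw [mem_closedBall, dist_zero_right]
    refine EuclideanSpace.norm_le_sqrt_card_mul x hM0 fun c => ?_
    have h1 := (hx c).1
    have h2 := (hx c).2
    have h3 := hMc c
    rw [abs_le]
    constructor <;> linarith [neg_abs_le (l c), le_abs_self (u c), abs_nonneg (l c), abs_nonneg (u c)]

/-- **One piece of the lattice partition lies in the closed span of the disjoint tensors.**  For
`G ∈ 𝓢((ℝ⁴)ⁿ, ℂ)` whose support has components separated by more than `12 h` and `β ∈ ℤ^{4n}`, the piece
`η_β · G` of the lattice partition of unity at mesh `h` belongs to the closure of the span of the real product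
tensors with compactly supported, pairwise disjoint factors: it is supported in the closed box
`∏ [(β_{ic} - 1) h, (β_{ic} + 1) h]`, which contains a point `v ∈ tsupport G` unless the piece vanishes; the box
engine `mem_closure_span_boxTensors` with outer box `∏ ((β_{ic} - 2) h, (β_{ic} + 2) h)` applies, its tensors have
factors supported in the bounded outer blocks, and two outer blocks `i ≠ j` are disjoint (a common point would
give `|vᵢ^c - vⱼ^c| < 6 h` for all `c`, so `‖vᵢ - vⱼ‖ ≤ 12 h`).  (Adapted from the tree's
`LocalOffDiagDensity.smulLeftCLM_latticeBump_mem_closure`.) [folklore] -/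
theorem smulLeftCLM_latticeBump_mem_closure_disjoint {n : ℕ}
    (G : 𝓢((Fin n → EuclideanSpace ℝ (Fin 4)), ℂ)) {h : ℝ} (hh : 0 < h)
    (hsep : ∀ v ∈ tsupport (G : (Fin n → EuclideanSpace ℝ (Fin 4)) → ℂ), ∀ i j : Fin n, i ≠ j →
      12 * h < ‖v i - v j‖) (β : Fin (n * 4) → ℤ) :
    SchwartzMap.smulLeftCLM ℂ (fun y => ((latticeBump (meshCoord n 4 h hh) β y : ℝ) : ℂ)) G ∈
      closure (Submodule.span ℂ {P : 𝓢((Fin n → EuclideanSpace ℝ (Fin 4)), ℂ) |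
        ∃ f : Fin n → 𝓢(EuclideanSpace ℝ (Fin 4), ℝ),
          (∀ i, HasCompactSupport (f i : EuclideanSpace ℝ (Fin 4) → ℝ)) ∧
          (∀ i j, i ≠ j → Disjoint (tsupport (f i : EuclideanSpace ℝ (Fin 4) → ℝ))
            (tsupport (f j : EuclideanSpace ℝ (Fin 4) → ℝ))) ∧
          IsTensorOf P (fun i => ofRealTest (f i))} :
        Set 𝓢((Fin n → EuclideanSpace ℝ (Fin 4)), ℂ)) := by
  set Gβ := SchwartzMap.smulLeftCLM ℂ (fun y => ((latticeBump (meshCoord n 4 h hh) β y : ℝ) : ℂ)) G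
    with hGβ
  -- the box of `β` in the coordinates `v_i^c`
  obtain ⟨b, hb⟩ : ∃ b : Fin n × Fin 4 → ℝ, ∀ ic, b ic = ((β (finProdFinEquiv ic) : ℤ) : ℝ) :=
    ⟨_, fun _ => rfl⟩
  have hbox : ∀ v ∈ tsupport (Gβ : (Fin n → EuclideanSpace ℝ (Fin 4)) → ℂ), ∀ ic : Fin n × Fin 4,
      b ic * h - h ≤ v ic.1 ic.2 ∧ v ic.1 ic.2 ≤ b ic * h + h := by
    intro v hv ic
    have h1 := (SchwartzMap.tsupport_smulLeftCLM_subset (F := ℂ) _ G hv).2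
    rw [tsupport_latticeBumpC (meshCoord n 4 h hh) β] at h1
    have h2 := tsupport_latticeBump_subset (meshCoord n 4 h hh) β h1 (finProdFinEquiv ic)
    rw [meshCoord_apply, mem_Icc, ← hb ic] at h2
    constructor
    · have h3 : b ic - 1 ≤ v ic.1 ic.2 / h := by linarith [h2.1]
      rw [le_div_iff₀ hh] at h3
      linarith
    · have h3 : v ic.1 ic.2 / h ≤ b ic + 1 := by linarith [h2.2]
      rw [div_le_iff₀ hh] at h3
      linarith
  -- the zero piece
  by_cases hG0 : Gβ = 0
  · rw [hG0]
    exact subset_closure (Submodule.zero_mem _)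
  -- otherwise a point of `tsupport G` lies in the box
  obtain ⟨v, hv⟩ : ∃ v, Gβ v ≠ 0 := by
    by_contra hcon
    push Not at hcon
    exact hG0 (SchwartzMap.ext hcon)
  have hvbox := hbox v (subset_tsupport _ hv)
  have hGv : G v ≠ 0 := by
    rw [hGβ, SchwartzMap.smulLeftCLM_apply_apply
      (hasTemperateGrowth_latticeBumpC (meshCoord n 4 h hh) β)] at hv
    exact right_ne_zero_of_smul hv
  have hvsep := hsep v (subset_tsupport _ hGv)
  -- the nested boxes and the box engine
  let B : BoxData n 4 :=
    { l := fun ic => b ic * h - 2 * h, u := fun ic => b ic * h + 2 * h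
      l' := fun ic => b ic * h - h, u' := fun ic => b ic * h + h
      hl := fun ic => by linarith, hl' := fun ic => by linarith, hu := fun ic => by linarith }
  let Λ₀ : EuclideanSpace ℝ (Fin 4) ≃L[ℝ] EuclideanSpace ℝ (Fin 4) := ContinuousLinearEquiv.refl ℝ _
  have hF' : tsupport (Gβ : (Fin n → EuclideanSpace ℝ (Fin 4)) → ℂ) ⊆
      {v | ∀ ic : Fin n × Fin 4, (Λ₀ (v ic.1)) ic.2 ∈ Icc (B.l' ic) (B.u' ic)} :=
    fun v hv ic => hbox v hv ic
  refine closure_mono (Submodule.span_mono ?_) (mem_closure_span_boxTensors Λ₀ B Gβ hF')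
  rintro P ⟨g, hg, hP⟩
  -- the factors are supported in the (open, bounded) outer blocks
  have hgk : ∀ (k : Fin n), ∀ x ∈ tsupport (g k : EuclideanSpace ℝ (Fin 4) → ℝ), ∀ c : Fin 4,
      b (k, c) * h - 2 * h < x c ∧ x c < b (k, c) * h + 2 * h := fun k x hx c => hg k hx c
  refine ⟨g, fun k => ?_, fun i j hij => ?_, hP⟩
  · -- compact support: the support is closed and inside a compact coordinate box
    refine IsCompact.of_isClosed_subset (isCompact_coordBox (fun c => b (k, c) * h - 2 * h)
      (fun c => b (k, c) * h + 2 * h)) (isClosed_tsupport _) fun x hx c => ?_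
    exact ⟨(hgk k x hx c).1.le, (hgk k x hx c).2.le⟩
  · -- pairwise disjoint supports: a common point forces `‖v_i - v_j‖ ≤ 12 h`
    rw [Set.disjoint_left]
    intro x hxi hxj
    have hcoord : ∀ c : Fin 4, |(v i - v j) c| ≤ 6 * h := by
      intro c
      rw [PiLp.sub_apply, abs_le]
      have h1 := hgk i x hxi c
      have h2 := hgk j x hxj c
      have h3 := hvbox (i, c)
      have h4 := hvbox (j, c)
      dsimp only at h3 h4
      constructor <;> linarith [h1.1, h1.2, h2.1, h2.2, h3.1, h3.2, h4.1, h4.2]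
    have hnorm := EuclideanSpace.norm_le_sqrt_card_mul (v i - v j) (by positivity) hcoord
    have h4 : Real.sqrt (Fintype.card (Fin 4) : ℕ) = 2 := by
      rw [Fintype.card_fin, Nat.cast_ofNat, show (4 : ℝ) = 2 ^ 2 by norm_num,
        Real.sqrt_sq (by norm_num)]
    rw [h4] at hnorm
    linarith [hvsep i j hij]

/-! ## The local density: compactly supported test functions off the diagonals -/

/-- **Compactly supported test functions off the diagonals are limits of disjoint tensors**: if
`G ∈ 𝓢((ℝ⁴)ⁿ, ℂ)` has compact support inside the complement of the coincidence locus, then `G` lies in the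
closure of the `ℂ`-span of the real product tensors with compactly supported, pairwise disjoint factors (mesh
below the separation; lattice partition of unity `W_R · G → G`; every piece by the local step). [folklore] -/
theorem localDensity_disjoint {n : ℕ} (G : 𝓢((Fin n → EuclideanSpace ℝ (Fin 4)), ℂ))
    (hG : HasCompactSupport (G : (Fin n → EuclideanSpace ℝ (Fin 4)) → ℂ))
    (hGA : tsupport (G : (Fin n → EuclideanSpace ℝ (Fin 4)) → ℂ) ⊆
      (coincidenceLocus n (EuclideanSpace ℝ (Fin 4)))ᶜ) :
    G ∈ closure (Submodule.span ℂ {P : 𝓢((Fin n → EuclideanSpace ℝ (Fin 4)), ℂ) |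
        ∃ f : Fin n → 𝓢(EuclideanSpace ℝ (Fin 4), ℝ),
          (∀ i, HasCompactSupport (f i : EuclideanSpace ℝ (Fin 4) → ℝ)) ∧
          (∀ i j, i ≠ j → Disjoint (tsupport (f i : EuclideanSpace ℝ (Fin 4) → ℝ))
            (tsupport (f j : EuclideanSpace ℝ (Fin 4) → ℝ))) ∧
          IsTensorOf P (fun i => ofRealTest (f i))} :
        Set 𝓢((Fin n → EuclideanSpace ℝ (Fin 4)), ℂ)) := by
  set S : Set 𝓢((Fin n → EuclideanSpace ℝ (Fin 4)), ℂ) :=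
    {P | ∃ f : Fin n → 𝓢(EuclideanSpace ℝ (Fin 4), ℝ),
      (∀ i, HasCompactSupport (f i : EuclideanSpace ℝ (Fin 4) → ℝ)) ∧
      (∀ i j, i ≠ j → Disjoint (tsupport (f i : EuclideanSpace ℝ (Fin 4) → ℝ))
        (tsupport (f j : EuclideanSpace ℝ (Fin 4) → ℝ))) ∧
      IsTensorOf P (fun i => ofRealTest (f i))}
  have hC : IsClosed (closure (Submodule.span ℂ S :
      Set 𝓢((Fin n → EuclideanSpace ℝ (Fin 4)), ℂ))) := isClosed_closure
  -- a mesh below the separation of the components on the compact `tsupport G` (the tree's `exists_mesh`)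
  have hmesh : ∃ h : ℝ, 0 < h ∧ ∀ v ∈ tsupport (G : (Fin n → EuclideanSpace ℝ (Fin 4)) → ℂ),
      ∀ i j : Fin n, i ≠ j → 12 * h < ‖v i - v j‖ := by
    have hK := hG.isCompact
    have hKA := hGA
    have hP : ∀ y ∈ tsupport (G : (Fin n → EuclideanSpace ℝ (Fin 4)) → ℂ), ∀ᶠ z : ℝ × (Fin n → EuclideanSpace ℝ (Fin 4)) in 𝓝 (0, y),
        ∀ i j : Fin n, i ≠ j → 12 * z.1 < ‖z.2 i - z.2 j‖ := by
      intro y hy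
      refine Filter.eventually_all.2 fun i => Filter.eventually_all.2 fun j => ?_
      by_cases hij : i = j
      · exact Eventually.of_forall fun z hne => absurd hij hne
      · have hyij : y i ≠ y j := fun hyeq => hKA hy ⟨i, j, hij, hyeq⟩
        have hopen : IsOpen {z : ℝ × (Fin n → EuclideanSpace ℝ (Fin 4)) |
            12 * z.1 < ‖z.2 i - z.2 j‖} :=
          isOpen_lt (continuous_const.mul continuous_fst)
            (((continuous_apply i).comp continuous_snd).sub
              ((continuous_apply j).comp continuous_snd)).norm
        have hmem : ((0 : ℝ), y) ∈ {z : ℝ × (Fin n → EuclideanSpace ℝ (Fin 4)) |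
            12 * z.1 < ‖z.2 i - z.2 j‖} := by
          simp only [mem_setOf_eq, mul_zero]
          exact norm_pos_iff.2 (sub_ne_zero.2 hyij)
        exact (hopen.eventually_mem hmem).mono fun z hz _ => hz
    have hev := hK.eventually_forall_of_forall_eventually
      (P := fun (h : ℝ) (v : Fin n → EuclideanSpace ℝ (Fin 4)) =>
        ∀ i j : Fin n, i ≠ j → 12 * h < ‖v i - v j‖) hP
    obtain ⟨h, hh, hsep⟩ := ((eventually_mem_nhdsWithin (a := (0 : ℝ)) (s := Ioi 0)).and
      (hev.filter_mono nhdsWithin_le_nhds)).exists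
    exact ⟨h, mem_Ioi.1 hh, hsep⟩
  obtain ⟨h, hh, hsep⟩ := hmesh
  set Λ := meshCoord n 4 h hh
  have hlim : Tendsto (fun R : ℕ => ∑ β ∈ latticeCube (n * 4) R,
      SchwartzMap.smulLeftCLM ℂ (fun y => ((latticeBump Λ β y : ℝ) : ℂ)) G) atTop (𝓝 G) := by
    have hsum : ∀ R : ℕ, ∑ β ∈ latticeCube (n * 4) R,
        SchwartzMap.smulLeftCLM ℂ (fun y => ((latticeBump Λ β y : ℝ) : ℂ)) G =
          SchwartzMap.smulLeftCLM ℂ (fun y => ((latticeWindow Λ R y : ℝ) : ℂ)) G := by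
      intro R
      have hW : (fun y => ((latticeWindow Λ R y : ℝ) : ℂ)) =
          fun y => ∑ β ∈ latticeCube (n * 4) R, ((latticeBump Λ β y : ℝ) : ℂ) := by
        funext y
        rw [← sum_latticeCube_latticeBump Λ R y, Complex.ofReal_sum]
      rw [hW, SchwartzMap.smulLeftCLM_sum fun β _ => hasTemperateGrowth_latticeBumpC Λ β,
        FunLike.coe_sum, Finset.sum_apply]
    simp_rw [hsum]
    exact tendsto_latticeWindow_smul Λ ℂ G
  refine hC.mem_of_tendsto hlim (Eventually.of_forall fun R => ?_)
  exact (Submodule.span ℂ S).topologicalClosure.sum_mem fun β _ =>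
    smulLeftCLM_latticeBump_mem_closure_disjoint G hh hsep β

/-! ## The global density and its functional form -/

/-- **`⁰𝒮` is the closed span of the disjoint tensors**: every Schwartz test function on `(ℝ⁴)ⁿ` flat on
the coincidence locus lies in the closure of the `ℂ`-span of the real product tensors `f₁ ⊗ ⋯ ⊗ fₙ` with
compactly supported, pairwise disjoint factors.  Proof: the off-diagonal cut-off family `ψ_k` of the tree
(`offDiagCutoffFamily`) gives `ψ_k F → F` in `𝓢` (`offDiagCutoffTendsto`); each `ψ_k F` vanishes near the
diagonals, so its compact inner cut-offs (Hörmander's `χ(x/m) · (ψ_k F) → ψ_k F`) are compactly supported off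
the coincidence locus and lie in the closed span by `localDensity_disjoint`. [folklore] -/
theorem isOffDiagonal_mem_closure_span_disjointTensors (n : ℕ)
    (F : 𝓢((Fin n → EuclideanSpace ℝ (Fin 4)), ℂ)) (hF : IsOffDiagonal F) :
    F ∈ closure (Submodule.span ℂ {P : 𝓢((Fin n → EuclideanSpace ℝ (Fin 4)), ℂ) |
        ∃ f : Fin n → 𝓢(EuclideanSpace ℝ (Fin 4), ℝ),
          (∀ i, HasCompactSupport (f i : EuclideanSpace ℝ (Fin 4) → ℝ)) ∧
          (∀ i j, i ≠ j → Disjoint (tsupport (f i : EuclideanSpace ℝ (Fin 4) → ℝ))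
            (tsupport (f j : EuclideanSpace ℝ (Fin 4) → ℝ))) ∧
          IsTensorOf P (fun i => ofRealTest (f i))} :
        Set 𝓢((Fin n → EuclideanSpace ℝ (Fin 4)), ℂ)) := by
  obtain ⟨C, ψ, hsmooth, h01, hone, hzero, hbound⟩ := offDiagCutoffFamily n
  obtain ⟨u, hu, hlim⟩ := offDiagCutoffTendsto n C ψ hsmooth h01 hone hbound F hF
  refine isClosed_closure.mem_of_tendsto hlim (Eventually.of_forall fun k => ?_)
  -- `u k` vanishes wherever some mutual distance is `≤ 1/(k+1)`, so its support avoids the locus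
  have hr : (0 : ℝ) < 1 / ((k : ℝ) + 1) := by positivity
  have hsupp : tsupport (u k : (Fin n → EuclideanSpace ℝ (Fin 4)) → ℂ) ⊆
      (coincidenceLocus n (EuclideanSpace ℝ (Fin 4)))ᶜ := by
    have hcl : IsClosed {x : Fin n → EuclideanSpace ℝ (Fin 4) |
        ∀ i j : Fin n, i ≠ j → 1 / ((k : ℝ) + 1) ≤ ‖x i - x j‖} := by
      simp only [Set.setOf_forall]
      exact isClosed_iInter fun i => isClosed_iInter fun j => isClosed_iInter fun _ =>
        isClosed_le continuous_const ((continuous_apply i).sub (continuous_apply j)).norm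
    have hsub : tsupport (u k : (Fin n → EuclideanSpace ℝ (Fin 4)) → ℂ) ⊆
        {x | ∀ i j : Fin n, i ≠ j → 1 / ((k : ℝ) + 1) ≤ ‖x i - x j‖} := by
      refine closure_minimal (fun y hy => ?_) hcl
      simp only [Set.mem_setOf_eq]
      intro i j hij
      by_contra hlt
      refine hy ?_
      rw [hu k y, hzero k y ⟨i, j, hij, (not_le.mp hlt).le⟩, Complex.ofReal_zero, zero_mul]
    refine hsub.trans ?_
    rintro x hx ⟨i, j, hij, hEq⟩
    have h := hx i j hij
    rw [hEq, sub_self, norm_zero] at h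
    exact absurd h (not_le.mpr hr)
  -- compact inner cut-offs of `u k` converge to it and lie in the closed span
  obtain ⟨v, hv, hvlim⟩ := exists_tsupport_subset_inter_closedBall_tendsto (u k)
  refine isClosed_closure.mem_of_tendsto hvlim (Eventually.of_forall fun m => ?_)
  refine localDensity_disjoint (v m) ?_ (((hv m).trans Set.inter_subset_left).trans hsupp)
  exact IsCompact.of_isClosed_subset (isCompact_closedBall _ _) (isClosed_tsupport _)
    ((hv m).trans Set.inter_subset_right)

/-- **A continuous linear functional on `𝓢((ℝ⁴)ⁿ, ℂ)` vanishing on the real product tensors with compactly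
supported, pairwise disjoint factors vanishes on all of `⁰𝒮`** (its kernel is a closed submodule containing
the generators). [folklore] -/
theorem eq_zero_offDiagonal_of_forall_disjointTensor {n : ℕ}
    (T : 𝓢((Fin n → EuclideanSpace ℝ (Fin 4)), ℂ) →L[ℂ] ℂ)
    (hT : ∀ (f : Fin n → 𝓢(EuclideanSpace ℝ (Fin 4), ℝ)) (P : 𝓢((Fin n → EuclideanSpace ℝ (Fin 4)), ℂ)),
      (∀ i, HasCompactSupport (f i : EuclideanSpace ℝ (Fin 4) → ℝ)) →
      (∀ i j, i ≠ j → Disjoint (tsupport (f i : EuclideanSpace ℝ (Fin 4) → ℝ))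
        (tsupport (f j : EuclideanSpace ℝ (Fin 4) → ℝ))) →
      IsTensorOf P (fun i => ofRealTest (f i)) → T P = 0)
    (F : 𝓢((Fin n → EuclideanSpace ℝ (Fin 4)), ℂ)) (hF : IsOffDiagonal F) : T F = 0 := by
  have hsub : (Submodule.span ℂ {P : 𝓢((Fin n → EuclideanSpace ℝ (Fin 4)), ℂ) |
      ∃ f : Fin n → 𝓢(EuclideanSpace ℝ (Fin 4), ℝ),
        (∀ i, HasCompactSupport (f i : EuclideanSpace ℝ (Fin 4) → ℝ)) ∧
        (∀ i j, i ≠ j → Disjoint (tsupport (f i : EuclideanSpace ℝ (Fin 4) → ℝ))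
          (tsupport (f j : EuclideanSpace ℝ (Fin 4) → ℝ))) ∧
        IsTensorOf P (fun i => ofRealTest (f i))} :
        Set 𝓢((Fin n → EuclideanSpace ℝ (Fin 4)), ℂ)) ⊆
      (LinearMap.ker (T : 𝓢((Fin n → EuclideanSpace ℝ (Fin 4)), ℂ) →ₗ[ℂ] ℂ) :
        Set 𝓢((Fin n → EuclideanSpace ℝ (Fin 4)), ℂ)) := by
    refine SetLike.coe_subset_coe.mpr (Submodule.span_le.mpr ?_)
    rintro P ⟨f, hc, hd, hP⟩
    exact LinearMap.mem_ker.mpr (hT f P hc hd hP)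
  have hmem := closure_minimal hsub T.isClosed_ker (isOffDiagonal_mem_closure_span_disjointTensors n F hF)
  exact LinearMap.mem_ker.mp hmem

end Summit.QuantumFields.YangMills.Theorems.OffDiagonalReduction

end
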